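import Mathlib.Analysis.Complex.Polynomial.Basic
import Mathlib.FieldTheory.IsAlgClosed.AlgebraicClosure
import Mathlib.FieldTheory.Galois.Basic
import Literature.Computability.AlgebraicComplexity.CircuitConstantCount
import Literature.Computability.AlgebraicComplexity.ZariskiClosureBaseChange
import HarnessLib

/-!
# AnyonJets — crux `JetConstantElim` (stmt-ValiantsHypothesis-16737), line `birth`:
# stub `stub_algebraicDescent` (descent of an optimal `ℂ`-circuit to `ℚ̄`)

Route `ValiantsHypothesis/AnyonJets`, crux `JetConstantElim`, registered line
`Cruxes/JetConstantElim/Lines/birth.lean` (descent `ℂ → ℚ̄` · integral multiple · sign simulation ·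
multiplier removal). This file proves the line's first, "known" stub, verbatim:

* `stub_algebraicDescent` — for every integer polynomial `f`, some fan-in-two circuit over
  `ℚ̄ = AlgebraicClosure ℚ` of size at most `L_ℂ(f)` computes `f`.

Proof (autarky of algebraically closed fields, Bürgisser–Clausen–Shokrollahi 1997, (4.15)–(4.17);
Bürgisser 2000, §4.1): an optimal fan-in-two `ℂ`-circuit `P` for `f` is the specialisation at a
point `c ∈ ℂ^T` of a symbolic skeleton `sk` over the alphabet `Fin T` (tree
`ArithCircuit.exists_skeleton`); "the specialisation of `sk` at `y` computes `f`" is the finite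
system of polynomial equations `coeff_m(genericEval sk)(y) = coeff_m(f)` with INTEGER right-hand
sides and rational (indeed integer) structure, read here over `ℚ̄` (tree `genericEval`,
`coeff_eval_mapConsts`, and the base change `genericEval_map` below); it has the solution `c` over
`ℂ ⊇ ℚ̄`, hence a solution `x` over the algebraically closed `ℚ̄` (tree Nullstellensatz descent
`exists_mem_zeroLocus_of_mem_zeroLocus`), and `Q := sk(x)` has the gates of `P`. The embedding
`ι : ℚ̄ → ℂ` used for the comparison is a CHOICE (`IsAlgClosed.lift`, via `Classical.choice`); the
statement proved does not depend on it.

Honest framing: a bookkeeping stub; the load-bearing stubs of the line (`stub_integralMultiple`,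
`stub_multiplierRemoval`) and the crux stay open; VP ≠ VNP is NOT proved here.
-/

noncomputable section

open MvPolynomial

-- the summit and the problem share the name `ValiantsHypothesis` (D-0017 single-conjunct layout)
set_option linter.dupNamespace false

namespace Summit.ValiantsHypothesis.ValiantsHypothesis.Theorems.AnyonJets.JetConstantElim

open Literature.Computability.AlgebraicComplexity
open Literature.Computability.AlgebraicComplexity.ArithCircuit

/-! ### Base change of the generic evaluation of a skeleton -/

section GenericEval

variable {k k' k'' : Type*} {σ : Type*}

/-- Functoriality of `Operand.map`. [folklore] -/
private theorem operand_map_map (φ : k → k') (ψ : k' → k'') (u : Operand k σ) :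
    (u.map φ).map ψ = u.map (ψ ∘ φ) := by
  cases u <;> rfl

/-- Functoriality of `Gate.map`. [folklore] -/
private theorem gate_map_map (φ : k → k') (ψ : k' → k'') (g : Gate k σ) :
    (g.map φ).map ψ = g.map (ψ ∘ φ) := by
  cases g <;> simp [Gate.map, List.map_map, Function.comp_def, operand_map_map]

/-- Functoriality of `mapConsts`. [folklore] -/
private theorem mapConsts_mapConsts' (φ : k → k') (ψ : k' → k'') (P : ArithCircuit k σ) :
    (P.mapConsts φ).mapConsts ψ = P.mapConsts (ψ ∘ φ) := by
  simp [mapConsts, List.map_map, Function.comp_def, gate_map_map, operand_map_map]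

/-- **The generic evaluation commutes with extension of the field of coefficients**: along a
homomorphism of fields `φ : F → F'`, `genericEval_{F'} sk = (genericEval_F sk)^φ` (the symbols
`X j` are fixed by `map φ`). [cite: BurgisserClausenShokrollahi1997, §9.1] -/
theorem genericEval_map {F F' : Type*} [Field F] [Field F'] (φ : F →+* F') {T : ℕ}
    (sk : ArithCircuit (Fin T) σ) :
    genericEval (F := F') sk =
      MvPolynomial.map (MvPolynomial.map φ) (genericEval (F := F) sk) := by
  unfold genericEval
  have h : sk.mapConsts (fun j => (X j : MvPolynomial (Fin T) F')) =
      (sk.mapConsts fun j => (X j : MvPolynomial (Fin T) F)).mapConsts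
        (MvPolynomial.map φ : MvPolynomial (Fin T) F →+* MvPolynomial (Fin T) F') := by
    rw [mapConsts_mapConsts']
    congr 1
    funext j
    simp
  rw [h, eval_mapConsts]

/-- Coefficientwise form of `genericEval_map`. [cite: BurgisserClausenShokrollahi1997, §9.1] -/
theorem coeff_genericEval_map {F F' : Type*} [Field F] [Field F'] (φ : F →+* F') {T : ℕ}
    (sk : ArithCircuit (Fin T) σ) (m : σ →₀ ℕ) :
    coeff m (genericEval (F := F') sk) = MvPolynomial.map φ (coeff m (genericEval (F := F) sk)) := by
  rw [genericEval_map φ sk, coeff_map]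

end GenericEval

/-! ### The descent -/

/-- **Stub `AlgebraicDescent`** (registered obligation `stub_algebraicDescent` of crux
`JetConstantElim`, line `birth`; signature verbatim): every integer polynomial `f` is computed by
a fan-in-two circuit over `ℚ̄` of size at most its complexity over `ℂ` (an optimal `ℂ`-circuit is a
`ℂ`-point of the skeleton's representation system, which is defined over `ℚ̄` and therefore has a
`ℚ̄`-point by the Nullstellensatz). [cite: BurgisserClausenShokrollahi1997, Prop. (4.16) and Thm. (4.17)(2)] -/
theorem stub_algebraicDescent :
    ∀ (σ : Type) (f : MvPolynomial σ ℤ),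
      ∃ Q : Literature.Computability.AlgebraicComplexity.ArithCircuit (AlgebraicClosure ℚ) σ,
        Q.IsFanInTwo ∧
        Q.Computes (MvPolynomial.map (Int.castRingHom (AlgebraicClosure ℚ)) f) ∧
        Q.size ≤ Literature.Computability.AlgebraicComplexity.complexity
          (MvPolynomial.map (Int.castRingHom ℂ) f) := by
  intro σ f
  classical
  -- `ℚ̄/ℚ` is Galois (hence algebraic) for the ambient `ℚ`-algebra structure; embed `ℚ̄ ↪ ℂ`
  haveI : IsGalois ℚ (AlgebraicClosure ℚ) :=
    @IsAlgClosure.isGalois ℚ (AlgebraicClosure ℚ) _ _ (AlgebraicClosure.instAlgebra ℚ) inferInstance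
      inferInstance
  let ι : AlgebraicClosure ℚ →ₐ[ℚ] ℂ := IsAlgClosed.lift
  letI : Algebra (AlgebraicClosure ℚ) ℂ := ι.toRingHom.toAlgebra
  have hιalg : algebraMap (AlgebraicClosure ℚ) ℂ = (ι : AlgebraicClosure ℚ →+* ℂ) := rfl
  have hιint : (algebraMap (AlgebraicClosure ℚ) ℂ).comp (Int.castRingHom (AlgebraicClosure ℚ)) =
      Int.castRingHom ℂ := RingHom.ext_int _ _
  -- an optimal circuit over `ℂ` and its symbolic skeleton
  obtain ⟨P, hP2, hPf, hsize⟩ :=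
    exists_computes_size_eq_complexity (MvPolynomial.map (Int.castRingHom ℂ) f)
  obtain ⟨ψ, c, hPc⟩ :=
    exists_skeleton (T := P.consts.length + 1) (Nat.succ_pos _) P (Nat.le_succ _)
  set sk : ArithCircuit (Fin (P.consts.length + 1)) σ := P.mapConsts ψ with hsk
  -- the representation system over `ℚ̄`
  set fb : MvPolynomial σ (AlgebraicClosure ℚ) :=
    MvPolynomial.map (Int.castRingHom (AlgebraicClosure ℚ)) f with hfb
  set G : MvPolynomial σ (MvPolynomial (Fin (P.consts.length + 1)) (AlgebraicClosure ℚ)) :=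
    genericEval (F := AlgebraicClosure ℚ) sk with hG
  set M : Finset (σ →₀ ℕ) := G.support ∪ fb.support with hM
  set I : Ideal (MvPolynomial (Fin (P.consts.length + 1)) (AlgebraicClosure ℚ)) :=
    Ideal.span ((fun m => coeff m G - C (coeff m fb)) '' (↑M : Set (σ →₀ ℕ))) with hI
  -- base change of `f` and of the equations to `ℂ`
  have hfbC : MvPolynomial.map (algebraMap (AlgebraicClosure ℚ) ℂ) fb =
      MvPolynomial.map (Int.castRingHom ℂ) f := by
    rw [hfb, MvPolynomial.map_map, hιint]
  have hcoeffG : ∀ (m : σ →₀ ℕ) (y : Fin (P.consts.length + 1) → ℂ),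
      aeval y (coeff m G) = coeff m (sk.mapConsts y).eval := by
    intro m y
    rw [coeff_eval_mapConsts, coeff_genericEval_map (algebraMap (AlgebraicClosure ℚ) ℂ) sk m,
      MvPolynomial.eval_map, aeval_def]
  -- `c` is a `ℂ`-point of the system
  have hc : c ∈ MvPolynomial.zeroLocus ℂ I := by
    rw [hI, MvPolynomial.zeroLocus_span]
    rintro p ⟨m, -, rfl⟩
    rw [map_sub, hcoeffG, aeval_C, hPc, hPf, ← hfbC, coeff_map, sub_self]
  -- hence a `ℚ̄`-point `x`
  obtain ⟨x, hx⟩ := exists_mem_zeroLocus_of_mem_zeroLocus I hc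
  rw [hI, MvPolynomial.zeroLocus_span] at hx
  have hxm : ∀ m ∈ M, MvPolynomial.eval x (coeff m G) = coeff m fb := by
    intro m hm
    have h1 := hx _ ⟨m, hm, rfl⟩
    rw [map_sub, sub_eq_zero, aeval_C, Algebra.algebraMap_self, RingHom.id_apply] at h1
    rw [← h1]
    rfl
  -- the descended circuit
  refine ⟨sk.mapConsts x, (hP2.mapConsts ψ).mapConsts x, ?_, ?_⟩
  · -- it computes `f` over `ℚ̄`: compare coefficients on and off `M`
    unfold ArithCircuit.Computes
    ext m
    rw [coeff_eval_mapConsts]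
    by_cases hm : m ∈ M
    · exact hxm m hm
    · have hmG : m ∉ G.support := fun h => hm (Finset.mem_union_left _ h)
      have hmf : m ∉ fb.support := fun h => hm (Finset.mem_union_right _ h)
      rw [notMem_support_iff] at hmG hmf
      rw [← hG, hmG, hmf, map_zero]
  · rw [size_mapConsts, hsk, size_mapConsts, hsize]

end Summit.ValiantsHypothesis.ValiantsHypothesis.Theorems.AnyonJets.JetConstantElim

end
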